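import Summits.CriticalPhenomena.CardyFormulaZ2.Theorems.CardyBoundaryCoulombGasHalfPlaneMarkDensityLawNearEndRegularity

/-!
# `HalfPlaneMarkDensityLaw` (crux stmt-CriticalPhenomena-5661), line `Sketch`:
# every joint subsequential limit is `C¹` ON THE CHAMBER (lead c4-0)

`P_n(a,b,c,y) = P_{1/2}[[⌊an⌋,⌊bn⌋]×{0} ↔ [⌊cn⌋,⌊yn⌋]×{0} in ℤ×ℕ]`; `G` a joint subsequential limit of
`P_n` along a strictly increasing `θ` (`exists_jointSubseqLimit`, c2-0: one exists along a subsequence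
of every subsequence).

* `continuousOn_deriv₂_jointLimit` — the second-mark derivative `(a,b,c,y) ↦ ∂₂G(a,b,c,y)` (which exists
  and is the limit along `θ` of the rescaled near-end density, `hasDerivAt_jointLimit_second`) is JOINTLY
  CONTINUOUS on the chamber `{a < b < c < y}` (uniform Taylor bounds of `…NearEndRegularity` + joint
  continuity of `G`, c2-0's `continuousOn_of_jointLimit`);
* `continuousOn_deriv₃_jointLimit` — so is the third-mark derivative, by the exact lattice reflection;
* `jointLimit_C1` (registered extra stub `stub_jointLimitC1`) — together with
  `continuousOn_deriv₁_jointLimit`, `continuousOn_deriv₄_jointLimit` (`…DensityUniform`): **all four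
  first partial derivatives of every joint subsequential scaling limit of the half-plane four-arc
  crossing probability of critical bond percolation on `ℤ²` exist and are jointly continuous on the
  whole chamber** — the limit is continuously differentiable, unconditionally, each partial being a
  (reflected) subsequential scaling limit of a lattice mark density (`∂₄` = the crux's own sequence).

What conformal invariance would add is only the IDENTIFICATION of these derivatives
(`halfPlaneMarkDensityLaw_iff_derivIdentification`).
-/

noncomputable section

namespace Summit.CriticalPhenomena.CardyFormulaZ2.Cruxes.HalfPlaneMarkDensityLaw.SketchLine

open Literature.Probability.Percolation Literature.Probability.LatticeModels
open MeasureTheory Filter Set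
open scoped Topology
open Summit.CriticalPhenomena.CardyFormulaZ2.Theorems.HalfPlaneMarkDensityLaw.Negative

namespace NearEnd

/-- Moving only the second coordinate to a common value does not increase the distance. [folklore] -/
theorem dist_fix_second_le (a' b' c' y' a b c y u : ℝ) :
    dist ((a', u, c', y') : ℝ × ℝ × ℝ × ℝ) (a, u, c, y) ≤
      dist ((a', b', c', y') : ℝ × ℝ × ℝ × ℝ) (a, b, c, y) := by
  simp only [Prod.dist_eq, dist_self]
  exact max_le_max le_rfl (max_le_max dist_nonneg le_rfl)

section JointLimit

variable {θ : ℕ → ℕ} {G : ℝ → ℝ → ℝ → ℝ → ℝ}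
  (hG : ∀ a b c y : ℝ, a < b → b < c → c < y →
    Tendsto (fun n ↦ μ.real (openCrossing halfPlane (arcA a b (θ n))
      (rowIcc ⌊c * (θ n : ℕ)⌋ ⌊y * (θ n : ℕ)⌋))) atTop (𝓝 (G a b c y)))
include hG

/-- **The second-mark derivative of a joint limit is jointly continuous on the chamber.** [folklore] -/
theorem continuousOn_deriv₂_jointLimit (hθ : StrictMono θ) :
    ContinuousOn (fun p : ℝ × ℝ × ℝ × ℝ ↦ deriv (fun s ↦ G p.1 s p.2.2.1 p.2.2.2) p.2.1)
      {p | p.1 < p.2.1 ∧ p.2.1 < p.2.2.1 ∧ p.2.2.1 < p.2.2.2} := by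
  rw [Metric.continuousOn_iff]
  rintro ⟨a, b, c, y⟩ ⟨hab, hbc, hcy⟩ η hη
  dsimp only at hab hbc hcy ⊢
  -- the separation scale `ε`: `8ε = min (b − a, c − b, y − c)`
  obtain ⟨ε, hε, hεab, hεbc, hεcy⟩ : ∃ ε : ℝ, 0 < ε ∧ 8 * ε ≤ b - a ∧ 8 * ε ≤ c - b ∧ 8 * ε ≤ y - c := by
    refine ⟨min (min (b - a) (c - b)) (y - c) / 8, ?_, ?_, ?_, ?_⟩
    · have : 0 < min (min (b - a) (c - b)) (y - c) :=
        lt_min (lt_min (by linarith) (by linarith)) (by linarith)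
      positivity
    · have : min (min (b - a) (c - b)) (y - c) ≤ b - a := (min_le_left _ _).trans (min_le_left _ _)
      linarith
    · have : min (min (b - a) (c - b)) (y - c) ≤ c - b := (min_le_left _ _).trans (min_le_right _ _)
      linarith
    · have : min (min (b - a) (c - b)) (y - c) ≤ y - c := min_le_right _ _
      linarith
  obtain ⟨C, hC0, hU⟩ := uniformRegularity_b hε
  -- joint continuity of `G` (c2-0)
  have hGc := Subseq.continuousOn_of_jointLimit hG hθ
  rw [Metric.continuousOn_iff] at hGc
  -- the step `t` with `2Ct ≤ η/4`, `t ≤ ε/2`, and the tolerance `κ = ηt/16`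
  obtain ⟨t, ht0, htε, htη⟩ : ∃ t : ℝ, 0 < t ∧ t ≤ ε / 2 ∧ 2 * C * t ≤ η / 4 := by
    refine ⟨min (ε / 2) (η / (8 * (C + 1))), by positivity, min_le_left _ _, ?_⟩
    have h1 : min (ε / 2) (η / (8 * (C + 1))) ≤ η / (8 * (C + 1)) := min_le_right _ _
    have h2 : C * (η / (8 * (C + 1))) ≤ η / 8 := by
      rw [mul_div_assoc', div_le_div_iff₀ (by positivity) (by positivity)]
      nlinarith
    have h3 : C * min (ε / 2) (η / (8 * (C + 1))) ≤ C * (η / (8 * (C + 1))) :=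
      mul_le_mul_of_nonneg_left h1 hC0
    linarith only [h2, h3]
  set κ : ℝ := η * t / 16 with hκ_def
  have hκ0 : 0 < κ := by rw [hκ_def]; positivity
  obtain ⟨δ₁, hδ₁, h₁⟩ := hGc (a, b + t, c, y)
    ⟨show a < b + t by linarith only [hab, ht0], show b + t < c by linarith only [hεbc, htε, hε], hcy⟩ κ hκ0
  obtain ⟨δ₂, hδ₂, h₂⟩ := hGc (a, b, c, y) ⟨hab, hbc, hcy⟩ κ hκ0
  -- the radius `δ`
  obtain ⟨δ, hδ, hδ₁', hδ₂', hδε, hδη⟩ : ∃ δ : ℝ, 0 < δ ∧ δ ≤ δ₁ ∧ δ ≤ δ₂ ∧ δ ≤ ε / 2 ∧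
      C * δ ≤ η / 4 := by
    refine ⟨min (min δ₁ δ₂) (min (ε / 2) (η / (4 * (C + 1)))), by positivity,
      (min_le_left _ _).trans (min_le_left _ _), (min_le_left _ _).trans (min_le_right _ _),
      (min_le_right _ _).trans (min_le_left _ _), ?_⟩
    have h1 : min (min δ₁ δ₂) (min (ε / 2) (η / (4 * (C + 1)))) ≤ η / (4 * (C + 1)) :=
      (min_le_right _ _).trans (min_le_right _ _)
    have h2 : C * (η / (4 * (C + 1))) ≤ η / 4 := by
      rw [mul_div_assoc', div_le_div_iff₀ (by positivity) (by positivity)]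
      nlinarith
    have h3 := mul_le_mul_of_nonneg_left h1 hC0
    linarith only [h2, h3]
  refine ⟨δ, hδ, ?_⟩
  rintro ⟨a', b', c', y'⟩ ⟨hab', hbc', hcy'⟩ hd
  dsimp only at hab' hbc' hcy' ⊢
  obtain ⟨hda, hdb, hdc, hdy⟩ := Density.dist_coords_lt (hd.trans_le hδε)
  dsimp only at hda hdb hdc hdy
  obtain ⟨hda1, hda2⟩ := abs_lt.1 hda
  obtain ⟨hdb1, hdb2⟩ := abs_lt.1 hdb
  obtain ⟨hdc1, hdc2⟩ := abs_lt.1 hdc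
  obtain ⟨hdy1, hdy2⟩ := abs_lt.1 hdy
  have hdbδ : |b' - b| < δ := (Density.dist_coords_lt hd).2.1
  -- the primed and unprimed marks are `4ε`-separated around the window `[b − ε, b + ε]`
  have ha'b : a' < b - ε := by linarith only [hda2, hεab, hε]
  have hbc'' : b + ε < c' := by linarith only [hdc1, hεbc, hε]
  obtain ⟨hT', hL'⟩ := hU a' c' y' (b - ε) (b + ε) (by linarith only [hda2, hεab, hε])
    (by linarith only [hdc1, hεbc, hε]) (by linarith only [hdc2, hdy1, hεcy, hε])
  obtain ⟨hT, -⟩ := hU a c y (b - ε) (b + ε) (by linarith only [hεab, hε])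
    (by linarith only [hεbc, hε]) (by linarith only [hεcy, hε])
  -- the three density limits involved
  have hρ := hasDerivAt_jointLimit_second hG hθ.tendsto_atTop hab hbc hcy
  have hρ' := hasDerivAt_jointLimit_second hG hθ.tendsto_atTop
    (show a' < b by linarith only [ha'b, hε]) (show b < c' by linarith only [hbc'', hε]) hcy'
  have hρ'' := hasDerivAt_jointLimit_second hG hθ.tendsto_atTop hab' hbc' hcy'
  -- (1) Lipschitz in the second mark at the primed marks
  have hstep1 : |deriv (fun s ↦ G a' s c' y') b' - deriv (fun s ↦ G a' s c' y') b| ≤ η / 4 := by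
    have h := hL' θ hθ.tendsto_atTop b b' _ _ (by linarith only [hε]) (by linarith only [hε])
      (by linarith only [hdb1, hε]) (by linarith only [hdb2, hε]) hρ'.2 hρ''.2
    have h' : C * |b' - b| ≤ C * δ := mul_le_mul_of_nonneg_left hdbδ.le hC0
    linarith only [h, h', hδη]
  -- (2) Taylor bounds at `b` with step `t`
  obtain ⟨ρ₁, -, hD₁, hR₁, -⟩ := hT' b ε hε le_rfl le_rfl θ hθ.tendsto_atTop (fun s ↦ G a' s c' y')
    (fun s hs₁ hs₂ ↦ hG a' s c' y' (by linarith only [hs₁, ha'b]) (by linarith only [hs₂, hbc'']) hcy')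
  obtain ⟨ρ₀, -, hD₀, hR₀, -⟩ := hT b ε hε le_rfl le_rfl θ hθ.tendsto_atTop (fun s ↦ G a s c y)
    (fun s hs₁ hs₂ ↦ hG a s c y (by linarith only [hs₁, hεab, hε]) (by linarith only [hs₂, hεbc, hε]) hcy)
  have hTay₁ := hR₁ t ht0 (by linarith only [htε, hε])
  have hTay₀ := hR₀ t ht0 (by linarith only [htε, hε])
  rw [hD₁.unique hρ'.1] at hTay₁
  rw [hD₀.unique hρ.1] at hTay₀
  -- (3) joint continuity of `G` at `(a,b+t,c,y)` and `(a,b,c,y)`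
  have hG₁ : |G a' (b + t) c' y' - G a (b + t) c y| < κ := by
    rw [← Real.dist_eq]
    exact h₁ (a', b + t, c', y') ⟨show a' < b + t by linarith only [ha'b, hε, ht0],
        show b + t < c' by linarith only [hbc'', htε, hε], hcy'⟩
      ((dist_fix_second_le a' b' c' y' a b c y (b + t)).trans_lt (hd.trans_le hδ₁'))
  have hG₂ : |G a' b c' y' - G a b c y| < κ := by
    rw [← Real.dist_eq]
    exact h₂ (a', b, c', y') ⟨show a' < b by linarith only [ha'b, hε],
        show b < c' by linarith only [hbc'', hε], hcy'⟩
      ((dist_fix_second_le a' b' c' y' a b c y b).trans_lt (hd.trans_le hδ₂'))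
  -- (4) `|ρ(q',b) − ρ(q,b)| · t ≤ 2κ + 2Ct² ≤ (η/2) t`
  have hstep2 : |deriv (fun s ↦ G a' s c' y') b - deriv (fun s ↦ G a s c y) b| ≤ η / 2 := by
    set X : ℝ := deriv (fun s ↦ G a' s c' y') b - deriv (fun s ↦ G a s c y) b with hX
    have key : X * t = (G a' (b + t) c' y' - G a (b + t) c y) - (G a' b c' y' - G a b c y)
        - (G a' (b + t) c' y' - G a' b c' y' - deriv (fun s ↦ G a' s c' y') b * t)
        + (G a (b + t) c y - G a b c y - deriv (fun s ↦ G a s c y) b * t) := by rw [hX]; ring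
    have e0 : |X| * t = |X * t| := by rw [abs_mul, abs_of_pos ht0]
    have hsub : ∀ u v : ℝ, |u - v| ≤ |u| + |v| := fun u v ↦ by
      simpa only [sub_eq_add_neg, abs_neg] using abs_add_le u (-v)
    have e1 := abs_add_le
      ((G a' (b + t) c' y' - G a (b + t) c y) - (G a' b c' y' - G a b c y)
        - (G a' (b + t) c' y' - G a' b c' y' - deriv (fun s ↦ G a' s c' y') b * t))
      (G a (b + t) c y - G a b c y - deriv (fun s ↦ G a s c y) b * t)
    have e2 := hsub
      ((G a' (b + t) c' y' - G a (b + t) c y) - (G a' b c' y' - G a b c y))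
      (G a' (b + t) c' y' - G a' b c' y' - deriv (fun s ↦ G a' s c' y') b * t)
    have e3 := hsub (G a' (b + t) c' y' - G a (b + t) c y) (G a' b c' y' - G a b c y)
    have h1 : |X| * t ≤ 2 * κ + 2 * C * t ^ 2 := by
      rw [e0, key]
      linarith only [e1, e2, e3, hG₁, hG₂, hTay₁, hTay₀]
    have h2 : 2 * κ + 2 * C * t ^ 2 ≤ (η / 2) * t := by
      have : 2 * κ + 2 * C * t ^ 2 = t * (η / 8 + 2 * C * t) := by rw [hκ_def]; ring
      rw [this, mul_comm (η / 2) t]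
      exact mul_le_mul_of_nonneg_left (by linarith only [htη, hη]) ht0.le
    exact le_of_mul_le_mul_right (h1.trans h2) ht0
  -- conclusion
  rw [Real.dist_eq]
  have e := abs_sub_le (deriv (fun s ↦ G a' s c' y') b') (deriv (fun s ↦ G a' s c' y') b)
    (deriv (fun s ↦ G a s c y) b)
  linarith only [e, hstep1, hstep2, hη]

/-- **The third-mark derivative of a joint limit is jointly continuous on the chamber**
(`∂₃G(a,b,c,y) = −∂₂G(−y,−c,−b,−a)`, `hasDerivAt_jointLimit_third`, and the reflection maps the chamber
continuously to itself). [folklore] -/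
theorem continuousOn_deriv₃_jointLimit (hθ : StrictMono θ) :
    ContinuousOn (fun p : ℝ × ℝ × ℝ × ℝ ↦ deriv (fun s ↦ G p.1 p.2.1 s p.2.2.2) p.2.2.1)
      {p | p.1 < p.2.1 ∧ p.2.1 < p.2.2.1 ∧ p.2.2.1 < p.2.2.2} := by
  have h2 := continuousOn_deriv₂_jointLimit hG hθ
  have hrefl : ContinuousOn (fun p : ℝ × ℝ × ℝ × ℝ ↦ ((-p.2.2.2, -p.2.2.1, -p.2.1, -p.1) : ℝ × ℝ × ℝ × ℝ))
      {p : ℝ × ℝ × ℝ × ℝ | p.1 < p.2.1 ∧ p.2.1 < p.2.2.1 ∧ p.2.2.1 < p.2.2.2} := by fun_prop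
  have hmaps : MapsTo (fun p : ℝ × ℝ × ℝ × ℝ ↦ ((-p.2.2.2, -p.2.2.1, -p.2.1, -p.1) : ℝ × ℝ × ℝ × ℝ))
      {p | p.1 < p.2.1 ∧ p.2.1 < p.2.2.1 ∧ p.2.2.1 < p.2.2.2}
      {p | p.1 < p.2.1 ∧ p.2.1 < p.2.2.1 ∧ p.2.2.1 < p.2.2.2} := by
    rintro ⟨a, b, c, y⟩ ⟨hab, hbc, hcy⟩
    dsimp only at hab hbc hcy ⊢
    exact ⟨by linarith, by linarith, by linarith⟩
  have hcomp := (h2.comp hrefl hmaps).neg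
  refine hcomp.congr ?_
  rintro ⟨a, b, c, y⟩ ⟨hab, hbc, hcy⟩
  dsimp only at hab hbc hcy
  show deriv (fun s ↦ G a b s y) c = -deriv (fun s ↦ G (-y) s (-b) (-a)) (-c)
  exact (hasDerivAt_jointLimit_third hG hθ hab hbc hcy).deriv

/-- **Every joint subsequential limit is `C¹` on the chamber**: all four first partial derivatives exist
at every chamber point (`differentiableAt_jointLimit_all`) and are jointly continuous there. [folklore] -/
theorem jointLimit_C1 (hθ : StrictMono θ) :
    (∀ a b c y : ℝ, a < b → b < c → c < y →
      DifferentiableAt ℝ (fun s ↦ G s b c y) a ∧ DifferentiableAt ℝ (fun s ↦ G a s c y) b ∧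
        DifferentiableAt ℝ (fun s ↦ G a b s y) c ∧ DifferentiableAt ℝ (fun s ↦ G a b c s) y) ∧
    ContinuousOn (fun p : ℝ × ℝ × ℝ × ℝ ↦ deriv (fun s ↦ G s p.2.1 p.2.2.1 p.2.2.2) p.1)
      {p | p.1 < p.2.1 ∧ p.2.1 < p.2.2.1 ∧ p.2.2.1 < p.2.2.2} ∧
    ContinuousOn (fun p : ℝ × ℝ × ℝ × ℝ ↦ deriv (fun s ↦ G p.1 s p.2.2.1 p.2.2.2) p.2.1)
      {p | p.1 < p.2.1 ∧ p.2.1 < p.2.2.1 ∧ p.2.2.1 < p.2.2.2} ∧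
    ContinuousOn (fun p : ℝ × ℝ × ℝ × ℝ ↦ deriv (fun s ↦ G p.1 p.2.1 s p.2.2.2) p.2.2.1)
      {p | p.1 < p.2.1 ∧ p.2.1 < p.2.2.1 ∧ p.2.2.1 < p.2.2.2} ∧
    ContinuousOn (fun p : ℝ × ℝ × ℝ × ℝ ↦ deriv (fun s ↦ G p.1 p.2.1 p.2.2.1 s) p.2.2.2)
      {p | p.1 < p.2.1 ∧ p.2.1 < p.2.2.1 ∧ p.2.2.1 < p.2.2.2} :=
  ⟨fun _ _ _ _ hab hbc hcy ↦ differentiableAt_jointLimit_all hG hθ hab hbc hcy,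
    Density.continuousOn_deriv₁_jointLimit hG hθ, continuousOn_deriv₂_jointLimit hG hθ,
    continuousOn_deriv₃_jointLimit hG hθ, Density.continuousOn_deriv₄_jointLimit hG hθ⟩

end JointLimit

/-- **Registered extra stub of line `Sketch` (lead c4-0): every joint subsequential limit of the collinear
half-plane crossing function of critical bond-`ℤ²` is `C¹` on the chamber**, closed form of
`jointLimit_C1`. [folklore] -/
theorem stub_jointLimitC1 :
    ∀ θ : ℕ → ℕ, StrictMono θ → ∀ G : ℝ → ℝ → ℝ → ℝ → ℝ,
      (∀ a b c y : ℝ, a < b → b < c → c < y →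
        Tendsto (fun n ↦ μ.real (openCrossing halfPlane (arcA a b (θ n))
          (rowIcc ⌊c * (θ n : ℕ)⌋ ⌊y * (θ n : ℕ)⌋))) atTop (𝓝 (G a b c y))) →
      (∀ a b c y : ℝ, a < b → b < c → c < y →
        DifferentiableAt ℝ (fun s ↦ G s b c y) a ∧ DifferentiableAt ℝ (fun s ↦ G a s c y) b ∧
          DifferentiableAt ℝ (fun s ↦ G a b s y) c ∧ DifferentiableAt ℝ (fun s ↦ G a b c s) y) ∧
      ContinuousOn (fun p : ℝ × ℝ × ℝ × ℝ ↦ deriv (fun s ↦ G s p.2.1 p.2.2.1 p.2.2.2) p.1)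
        {p | p.1 < p.2.1 ∧ p.2.1 < p.2.2.1 ∧ p.2.2.1 < p.2.2.2} ∧
      ContinuousOn (fun p : ℝ × ℝ × ℝ × ℝ ↦ deriv (fun s ↦ G p.1 s p.2.2.1 p.2.2.2) p.2.1)
        {p | p.1 < p.2.1 ∧ p.2.1 < p.2.2.1 ∧ p.2.2.1 < p.2.2.2} ∧
      ContinuousOn (fun p : ℝ × ℝ × ℝ × ℝ ↦ deriv (fun s ↦ G p.1 p.2.1 s p.2.2.2) p.2.2.1)
        {p | p.1 < p.2.1 ∧ p.2.1 < p.2.2.1 ∧ p.2.2.1 < p.2.2.2} ∧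
      ContinuousOn (fun p : ℝ × ℝ × ℝ × ℝ ↦ deriv (fun s ↦ G p.1 p.2.1 p.2.2.1 s) p.2.2.2)
        {p | p.1 < p.2.1 ∧ p.2.1 < p.2.2.1 ∧ p.2.2.1 < p.2.2.2} :=
  fun _ hθ _ hG ↦ jointLimit_C1 hG hθ

end NearEnd

end Summit.CriticalPhenomena.CardyFormulaZ2.Cruxes.HalfPlaneMarkDensityLaw.SketchLine
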